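import Literature.Analysis.FluidPDE.LocalHelmholtzSupBound
import Literature.Analysis.FluidPDE.BiotSavartNewtonKernel
import Literature.Analysis.FluidPDE.MildSolutionProofs
import Literature.Analysis.FluidPDE.BallCutoff
import HarnessLib

/-!
# A local Biot–Savart / Helmholtz representation with one fixed cutoff, and the sup bound for the
# velocity generated by the low vorticity on a ball

Analysis/FluidPDE proof file (theorems only: no definition, no named fact, no `sorry`), first brick
of the discharge of the named fact `Literature.Analysis.FluidPDE.grujic2009_localized_halfHolder_coherence`
(`GrujicLocalizedCoherence.lean`; Z. Grujić, *Localization and geometric depletion of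
vortex-stretching in the 3D NSE*, Comm. Math. Phys. **290** (2009) 861–870, Thm. 1).

Grujić's localization of the vortex-stretching term (§3, pp. 864–865, formula (3):
"First write `φuⱼ = c∫ (1/|x−y|) Δ(φuⱼ) dy = c∫ (1/|x−y|) φ (curl ω)ⱼ dy + c∫ (1/|x−y|)(2∇φ·∇uⱼ + Δφ uⱼ) dy
= I₁ + I₂ … note that the terms in `I₂` are the lower order terms with respect to `I₁`") is the
Green representation of the compactly supported field `φu` by the Newtonian potential of its
Laplacian, with `Δu = −curl ω` (`div u = 0`). We prove it in the following form, for a field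
`V ∈ C²(ℝ³; ℝ³)` and a cutoff `χ ∈ C²_c(ℝ³)` (no divergence condition is needed for the identity
itself):

* `smul_eq_biotSavart_add_integral_newtonKernel` —
  `χ(x) V(x) = (K ∗ (χ ω))(x) + ∫ Γ(x − y) G(y) dy`, `ω = curl V`, `K` the Biot–Savart kernel
  (`biotSavart`), `Γ = −(4π|z|)⁻¹` the Newtonian kernel (`newtonKernel`), and
  `G = Δ(χV) + curl(χω)` (Green's representation `integral_newtonKernel_smul_laplacian` and
  `K ∗ Φ = −Γ ∗ curl Φ`, `biotSavart_eq_neg_integral_newtonKernel_smul_curl`);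
* `laplacian_smul_add_curl_smul_curl_eq` — where `div V = 0` near `y` (or `χ(y) = 0`),
  `G(y) = ∇χ(y) × ω(y) + 2 Σᵢ ∂ᵢχ(y) ∂ᵢV(y) + Δχ(y) V(y)` (Leibniz rules `laplacian_smul_apply`,
  `curl_smul`, and `curl curl = ∇ div − Δ`, `curl_curl_eq_sum_fderiv_divergence_sub_laplacian`):
  Grujić's lower-order terms `I₂` and `J₂`, supported where `∇χ ≠ 0`, with the pointwise bound
  `norm_laplacian_smul_add_curl_smul_curl_le`;
* `exists_norm_sub_biotSavart_ballCutoff_le` — **the sup bound used by the localized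
  Constantin–Fefferman argument**: with `χ = ballCutoff c (2s)` (`= 1` on `B̄(c, 4s)`, `= 0` off
  `B(c, 6s)`), for `V` divergence free on `B(c, 6s)`, any continuous `b` with
  `‖curl V − b‖ ≤ Λ` on `B(c, 6s)`, and `x ∈ B(c, 3s)`,
  `‖V(x) − (K ∗ (χ b))(x)‖ ≤ 30 Λ s + C ∫_{B̄(c,6s)} (‖curl V‖ + ‖∇V‖ + ‖V‖)`
  with `C` depending on `c, s` only (`K ∗ (χ(ω − b))` by Majda–Bertozzi's Lemma 4.5,
  `norm_biotSavart_le_of_support_subset`; the Newtonian term lives on the shell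
  `4s ≤ |y − c| ≤ 6s`, at distance `≥ s` from `x`, where `|Γ(x − y)| ≤ (4πs)⁻¹`).
  This is the local substitute for the tree's whole-space `exists_norm_sub_biotSavart_le`
  (`LocalHelmholtzSupBound.lean`), for fields that are smooth and divergence free only on a ball.

## References

* Z. Grujić, Comm. Math. Phys. 290 (2009) 861–870, §3 (3)–(4) (the localization formula and its
  lower-order terms). [Grujic2009]
* A. J. Majda, A. L. Bertozzi, *Vorticity and Incompressible Flow*, CUP 2002, §2.4.1 Prop. 2.16
  (Biot–Savart via the Newtonian potential), §4.1.3 Lemma 4.5. [MajdaBertozziCUP2002]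
* D. Gilbarg, N. S. Trudinger (2001), (2.17) (Green's representation).
-/

noncomputable section

open MeasureTheory Set Function Filter Metric Real InnerProductSpace
open _root_.Topology
open scoped ENNReal NNReal RealInnerProductSpace Laplacian ContDiff

namespace Literature.Analysis.FluidPDE

-- nested operator types (second derivatives)
set_option maxSynthPendingDepth 3

/-! ### The representation with one cutoff -/

/-- **Local Biot–Savart / Helmholtz representation with a fixed cutoff** (Grujić 2009, §3 (3):
"`φuⱼ = c∫(1/|x−y|) φ (curl ω)ⱼ dy + c∫(1/|x−y|)(2∇φ·∇uⱼ + Δφ uⱼ) dy = I₁ + I₂`", with `I₁`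
rewritten through `J₁ + J₂`, i.e. through the Biot–Savart integral of `φω`). For `V ∈ C²(ℝ³;ℝ³)`,
`χ ∈ C²_c(ℝ³; ℝ)` and every `x`,
`χ(x) V(x) = (K ∗ (χ curl V))(x) + ∫ Γ(x − y) (Δ(χV) + curl(χ curl V))(y) dy`.
Proof: Green's representation `χV = Γ ∗ Δ(χV)` (`integral_newtonKernel_smul_laplacian`) and
`K ∗ Φ = −Γ ∗ curl Φ` for `Φ = χ curl V ∈ C¹_c` (`biotSavart_eq_neg_integral_newtonKernel_smul_curl`).
No divergence condition is used here. [cite: Grujic2009, §3 (3) (p. 864–865); MajdaBertozziCUP2002, §2.4.1 Prop. 2.16] -/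
theorem smul_eq_biotSavart_add_integral_newtonKernel
    {V : (EuclideanSpace ℝ (Fin 3)) → (EuclideanSpace ℝ (Fin 3))} (hV : ContDiff ℝ 2 V)
    {χ : (EuclideanSpace ℝ (Fin 3)) → ℝ} (hχ : ContDiff ℝ 2 χ) (hχc : HasCompactSupport χ)
    (x : (EuclideanSpace ℝ (Fin 3))) :
    χ x • V x = biotSavart (fun y => χ y • curl V y) x +
      ∫ y, newtonKernel (x - y) •
        ((Δ (fun z => χ z • V z)) y + curl (fun z => χ z • curl V z) y) := by
  -- the objects
  set U : (EuclideanSpace ℝ (Fin 3)) → (EuclideanSpace ℝ (Fin 3)) := fun z => χ z • V z with hU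
  set Φ : (EuclideanSpace ℝ (Fin 3)) → (EuclideanSpace ℝ (Fin 3)) := fun z => χ z • curl V z with hΦ
  have hU2 : ContDiff ℝ 2 U := hχ.smul hV
  have hUc : HasCompactSupport U := hχc.smul_right
  have hω1 : ContDiff ℝ 1 (curl V) := contDiff_curl (n := 1) (by exact hV)
  have hΦ1 : ContDiff ℝ 1 Φ := (hχ.of_le (by norm_num)).smul hω1
  have hΦc : HasCompactSupport Φ := hχc.smul_right
  -- continuity and compact support of `ΔU` and `curl Φ`
  have hΔUc : Continuous (Δ U) := (contDiff_laplacian (n := 0) (by exact hU2)).continuous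
  have hΔUs : HasCompactSupport (Δ U) :=
    HasCompactSupport.of_support_subset_isCompact hUc.isCompact fun y hy => by
      by_contra h
      exact hy (laplacian_eq_zero_of_notMem_tsupport h)
  have hcΦ : Continuous (curl Φ) := continuous_curl hΦ1
  have hcΦs : HasCompactSupport (curl Φ) := hasCompactSupport_curl hΦc
  -- Green's representation and the Biot–Savart / Newton identity
  have hGreen : ∫ y, newtonKernel (x - y) • (Δ U) y = U x :=
    integral_newtonKernel_smul_laplacian hU2 hUc x
  have hBS : biotSavart Φ x = -∫ y, newtonKernel (x - y) • curl Φ y :=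
    biotSavart_eq_neg_integral_newtonKernel_smul_curl hΦ1 hΦc x
  have hI1 : Integrable fun y => newtonKernel (x - y) • (Δ U) y :=
    integrable_newtonKernel_smul hΔUc hΔUs x
  have hI2 : Integrable fun y => newtonKernel (x - y) • curl Φ y :=
    integrable_newtonKernel_smul hcΦ hcΦs x
  have hsum : ∫ y, newtonKernel (x - y) • ((Δ U) y + curl Φ y) =
      (∫ y, newtonKernel (x - y) • (Δ U) y) + ∫ y, newtonKernel (x - y) • curl Φ y := by
    rw [← integral_add hI1 hI2]
    refine integral_congr_ae (Eventually.of_forall fun y => ?_)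
    simp only [smul_add]
  show U x = biotSavart Φ x + ∫ y, newtonKernel (x - y) • ((Δ U) y + curl Φ y)
  rw [hsum, hGreen, hBS]
  abel

/-! ### The lower-order terms -/

/-- `curl (curl V)(y) = −ΔV(y)` at a point near which `V ∈ C²` is divergence free
(`curl curl = ∇ div − Δ` and `∇(div V)(y) = 0`). [folklore] -/
private theorem curl_curl_eq_neg_laplacian_of_eventually_divergence_eq_zero
    {V : (EuclideanSpace ℝ (Fin 3)) → (EuclideanSpace ℝ (Fin 3))} (hV : ContDiff ℝ 2 V)
    {y : (EuclideanSpace ℝ (Fin 3))} (hdiv : ∀ᶠ z in 𝓝 y, VectorCalculus.divergence V z = 0) :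
    curl (curl V) y = -(Δ V) y := by
  have hD : fderiv ℝ (VectorCalculus.divergence V) y = 0 := by
    have h : VectorCalculus.divergence V =ᶠ[𝓝 y] fun _ => (0 : ℝ) := hdiv
    rw [h.fderiv_eq]
    exact fderiv_const_apply 0
  rw [curl_curl_eq_sum_fderiv_divergence_sub_laplacian hV y, hD]
  simp

/-- **The lower-order terms of the localization formula** (Grujić 2009, §3: the terms `I₂`
(`2∇φ·∇uⱼ + Δφ uⱼ`) and `J₂` (`ε_{jkl} (∂ₖφ) ωₗ`)). For `V, χ ∈ C²` and a point `y` such that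
`χ(y) = 0` or `div V = 0` near `y`:
`Δ(χV)(y) + curl(χ curl V)(y) = ∇χ(y) × curl V(y) + 2 Σᵢ ∂ᵢχ(y) ∂ᵢV(y) + Δχ(y) V(y)`
(the first term written basis-free as `curlCLM (Dχ(y) ⊗ curl V(y))`, the sum over the standard
orthonormal frame). [cite: Grujic2009, §3 (3)–(4) (pp. 864–865)] -/
theorem laplacian_smul_add_curl_smul_curl_eq
    {V : (EuclideanSpace ℝ (Fin 3)) → (EuclideanSpace ℝ (Fin 3))} (hV : ContDiff ℝ 2 V)
    {χ : (EuclideanSpace ℝ (Fin 3)) → ℝ} (hχ : ContDiff ℝ 2 χ) {y : (EuclideanSpace ℝ (Fin 3))}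
    (hdiv : χ y = 0 ∨ ∀ᶠ z in 𝓝 y, VectorCalculus.divergence V z = 0) :
    (Δ (fun z => χ z • V z)) y + curl (fun z => χ z • curl V z) y =
      curlCLM ((fderiv ℝ χ y).smulRight (curl V y)) +
        (2 : ℝ) • ∑ i, (fderiv ℝ χ y (stdOrthonormalBasis ℝ (EuclideanSpace ℝ (Fin 3)) i)) •
          fderiv ℝ V y (stdOrthonormalBasis ℝ (EuclideanSpace ℝ (Fin 3)) i) +
        ((Δ χ) y) • V y := by
  have hω1 : ContDiff ℝ 1 (curl V) := contDiff_curl (n := 1) (by exact hV)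
  have hχd : DifferentiableAt ℝ χ y := (hχ.differentiable (by norm_num)) y
  have hωd : DifferentiableAt ℝ (curl V) y := (hω1.differentiable one_ne_zero) y
  -- the key cancellation `χ(y) ΔV(y) + χ(y) curl(curl V)(y) = 0`
  have hkey : χ y • (Δ V) y + χ y • curl (curl V) y = 0 := by
    rcases hdiv with h0 | hd
    · rw [h0, zero_smul, zero_smul, add_zero]
    · rw [curl_curl_eq_neg_laplacian_of_eventually_divergence_eq_zero hV hd, smul_neg, add_neg_cancel]
  rw [laplacian_smul_apply hχ hV y, curl_smul hχd hωd]
  have e : χ y • (Δ V) y +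
        (2 : ℝ) • ∑ i, (fderiv ℝ χ y (stdOrthonormalBasis ℝ (EuclideanSpace ℝ (Fin 3)) i)) •
          fderiv ℝ V y (stdOrthonormalBasis ℝ (EuclideanSpace ℝ (Fin 3)) i) +
        ((Δ χ) y) • V y + (χ y • curl (curl V) y + curlCLM ((fderiv ℝ χ y).smulRight (curl V y))) =
      (χ y • (Δ V) y + χ y • curl (curl V) y) + (curlCLM ((fderiv ℝ χ y).smulRight (curl V y)) +
        (2 : ℝ) • ∑ i, (fderiv ℝ χ y (stdOrthonormalBasis ℝ (EuclideanSpace ℝ (Fin 3)) i)) •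
          fderiv ℝ V y (stdOrthonormalBasis ℝ (EuclideanSpace ℝ (Fin 3)) i) +
        ((Δ χ) y) • V y) := by abel
  rw [e, hkey, zero_add]

/-- The norm of one term `∂ᵢχ(y) ∂ᵢV(y)` of the Leibniz sum, for a unit frame vector. [folklore] -/
private theorem norm_fderiv_apply_smul_fderiv_apply_le
    {V : (EuclideanSpace ℝ (Fin 3)) → (EuclideanSpace ℝ (Fin 3))} {χ : (EuclideanSpace ℝ (Fin 3)) → ℝ}
    (y : (EuclideanSpace ℝ (Fin 3))) {e : (EuclideanSpace ℝ (Fin 3))} (he : ‖e‖ = 1) :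
    ‖(fderiv ℝ χ y e) • fderiv ℝ V y e‖ ≤ ‖fderiv ℝ χ y‖ * ‖fderiv ℝ V y‖ := by
  rw [norm_smul]
  have ha : ‖fderiv ℝ χ y e‖ ≤ ‖fderiv ℝ χ y‖ := by
    calc ‖fderiv ℝ χ y e‖ ≤ ‖fderiv ℝ χ y‖ * ‖e‖ := ContinuousLinearMap.le_opNorm _ _
      _ = ‖fderiv ℝ χ y‖ := by rw [he, mul_one]
  have hc : ‖fderiv ℝ V y e‖ ≤ ‖fderiv ℝ V y‖ := by
    calc ‖fderiv ℝ V y e‖ ≤ ‖fderiv ℝ V y‖ * ‖e‖ := ContinuousLinearMap.le_opNorm _ _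
      _ = ‖fderiv ℝ V y‖ := by rw [he, mul_one]
  exact mul_le_mul ha hc (norm_nonneg _) (norm_nonneg _)

/-- The Leibniz sum `2 Σᵢ ∂ᵢχ(y) ∂ᵢV(y)` over the standard orthonormal frame of `ℝ³` is bounded by
`6 ‖Dχ(y)‖ ‖DV(y)‖`. [folklore] -/
private theorem norm_two_smul_sum_fderiv_apply_smul_le
    {V : (EuclideanSpace ℝ (Fin 3)) → (EuclideanSpace ℝ (Fin 3))} {χ : (EuclideanSpace ℝ (Fin 3)) → ℝ}
    (y : (EuclideanSpace ℝ (Fin 3))) :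
    ‖(2 : ℝ) • ∑ i, (fderiv ℝ χ y (stdOrthonormalBasis ℝ (EuclideanSpace ℝ (Fin 3)) i)) •
        fderiv ℝ V y (stdOrthonormalBasis ℝ (EuclideanSpace ℝ (Fin 3)) i)‖ ≤
      6 * ‖fderiv ℝ χ y‖ * ‖fderiv ℝ V y‖ := by
  have hbi : ∀ i, ‖stdOrthonormalBasis ℝ (EuclideanSpace ℝ (Fin 3)) i‖ = 1 := fun i =>
    (stdOrthonormalBasis ℝ (EuclideanSpace ℝ (Fin 3))).orthonormal.1 i
  have hcard : (Finset.univ : Finset (Fin (Module.finrank ℝ (EuclideanSpace ℝ (Fin 3))))).card = 3 := by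
    rw [Finset.card_univ, Fintype.card_fin, finrank_euclideanSpace_fin]
  have hsum : ‖∑ i, (fderiv ℝ χ y (stdOrthonormalBasis ℝ (EuclideanSpace ℝ (Fin 3)) i)) •
      fderiv ℝ V y (stdOrthonormalBasis ℝ (EuclideanSpace ℝ (Fin 3)) i)‖ ≤
      3 * (‖fderiv ℝ χ y‖ * ‖fderiv ℝ V y‖) := by
    calc ‖∑ i, (fderiv ℝ χ y (stdOrthonormalBasis ℝ (EuclideanSpace ℝ (Fin 3)) i)) •
          fderiv ℝ V y (stdOrthonormalBasis ℝ (EuclideanSpace ℝ (Fin 3)) i)‖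
        ≤ ∑ i, ‖(fderiv ℝ χ y (stdOrthonormalBasis ℝ (EuclideanSpace ℝ (Fin 3)) i)) •
          fderiv ℝ V y (stdOrthonormalBasis ℝ (EuclideanSpace ℝ (Fin 3)) i)‖ := norm_sum_le _ _
      _ ≤ ∑ _i : Fin (Module.finrank ℝ (EuclideanSpace ℝ (Fin 3))), ‖fderiv ℝ χ y‖ * ‖fderiv ℝ V y‖ :=
          Finset.sum_le_sum fun i _ => norm_fderiv_apply_smul_fderiv_apply_le y (hbi i)
      _ = 3 * (‖fderiv ℝ χ y‖ * ‖fderiv ℝ V y‖) := by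
          rw [Finset.sum_const, hcard, nsmul_eq_mul, Nat.cast_ofNat]
  rw [norm_smul, Real.norm_eq_abs, abs_of_pos (by norm_num : (0:ℝ) < 2)]
  nlinarith [hsum, norm_nonneg (fderiv ℝ χ y), norm_nonneg (fderiv ℝ V y)]

set_option maxHeartbeats 400000 in
/-- **Pointwise bound for the lower-order terms**: under the hypothesis of
`laplacian_smul_add_curl_smul_curl_eq`,
`‖Δ(χV)(y) + curl(χ curl V)(y)‖ ≤ ‖curlCLM‖ ‖Dχ(y)‖ ‖curl V(y)‖ + 6 ‖Dχ(y)‖ ‖DV(y)‖ + |Δχ(y)| ‖V(y)‖`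
— the size of Grujić's lower-order terms `I₂`, `J₂` ("either lower order for at least one order of the
differentiation or/and less singular", §3 after (4)). [cite: Grujic2009, §3 (3)–(4) (pp. 864–865, the lower-order terms)] -/
theorem norm_laplacian_smul_add_curl_smul_curl_le
    {V : (EuclideanSpace ℝ (Fin 3)) → (EuclideanSpace ℝ (Fin 3))} (hV : ContDiff ℝ 2 V)
    {χ : (EuclideanSpace ℝ (Fin 3)) → ℝ} (hχ : ContDiff ℝ 2 χ) {y : (EuclideanSpace ℝ (Fin 3))}
    (hdiv : χ y = 0 ∨ ∀ᶠ z in 𝓝 y, VectorCalculus.divergence V z = 0) :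
    ‖(Δ (fun z => χ z • V z)) y + curl (fun z => χ z • curl V z) y‖ ≤
      ‖curlCLM‖ * ‖fderiv ℝ χ y‖ * ‖curl V y‖ + 6 * ‖fderiv ℝ χ y‖ * ‖fderiv ℝ V y‖ +
        |(Δ χ) y| * ‖V y‖ := by
  rw [laplacian_smul_add_curl_smul_curl_eq hV hχ hdiv]
  have h1 : ‖curlCLM ((fderiv ℝ χ y).smulRight (curl V y))‖ ≤
      ‖curlCLM‖ * ‖fderiv ℝ χ y‖ * ‖curl V y‖ := by
    calc ‖curlCLM ((fderiv ℝ χ y).smulRight (curl V y))‖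
        ≤ ‖curlCLM‖ * ‖(fderiv ℝ χ y).smulRight (curl V y)‖ := ContinuousLinearMap.le_opNorm _ _
      _ = ‖curlCLM‖ * ‖fderiv ℝ χ y‖ * ‖curl V y‖ := by
          rw [ContinuousLinearMap.norm_smulRight_apply, mul_assoc]
  have h2 := norm_two_smul_sum_fderiv_apply_smul_le (V := V) (χ := χ) y
  have h3 : ‖((Δ χ) y) • V y‖ ≤ |(Δ χ) y| * ‖V y‖ := by
    rw [norm_smul, Real.norm_eq_abs]
  exact (norm_add₃_le.trans (add_le_add (add_le_add h1 h2) h3))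

/-- The lower-order terms vanish where the cutoff is locally constant (`Dχ(y) = 0`, `Δχ(y) = 0`),
in particular inside the plateau `{χ = 1}` and off the support of `χ`. [folklore] -/
private theorem laplacian_smul_add_curl_smul_curl_eq_zero_of_eventuallyEq_const
    {V : (EuclideanSpace ℝ (Fin 3)) → (EuclideanSpace ℝ (Fin 3))} (hV : ContDiff ℝ 2 V)
    {χ : (EuclideanSpace ℝ (Fin 3)) → ℝ} (hχ : ContDiff ℝ 2 χ) {y : (EuclideanSpace ℝ (Fin 3))} {a : ℝ}
    (hconst : χ =ᶠ[𝓝 y] fun _ => a)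
    (hdiv : χ y = 0 ∨ ∀ᶠ z in 𝓝 y, VectorCalculus.divergence V z = 0) :
    (Δ (fun z => χ z • V z)) y + curl (fun z => χ z • curl V z) y = 0 := by
  have hD : fderiv ℝ χ y = 0 := by
    rw [hconst.fderiv_eq]
    exact fderiv_const_apply a
  have hL : (Δ χ) y = 0 := by
    rw [(laplacian_congr_nhds hconst).eq_of_nhds]
    simp
  rw [laplacian_smul_add_curl_smul_curl_eq hV hχ hdiv, hD, hL]
  simp

/-! ### The sup bound for the velocity of the low vorticity on a ball -/

/-- Linearity of the Biot–Savart integral for bounded, integrable, measurable densities. [folklore] -/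
private theorem biotSavart_add_of_bounded
    {f g : (EuclideanSpace ℝ (Fin 3)) → (EuclideanSpace ℝ (Fin 3))} {Cf Cg : ℝ}
    (hfm : Measurable f) (hfi : Integrable f) (hfb : ∀ y, ‖f y‖ ≤ Cf)
    (hgm : Measurable g) (hgi : Integrable g) (hgb : ∀ y, ‖g y‖ ≤ Cg) (x : (EuclideanSpace ℝ (Fin 3))) :
    biotSavart (fun y => f y + g y) x = biotSavart f x + biotSavart g x := by
  simp only [biotSavart]
  rw [← integral_add (integrable_biotSavartKernel_sub_apply hfm hfi hfb x)
    (integrable_biotSavartKernel_sub_apply hgm hgi hgb x)]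
  refine integral_congr_ae (Eventually.of_forall fun y => ?_)
  show biotSavartKernel (x - y) (f y + g y) = biotSavartKernel (x - y) (f y) + biotSavartKernel (x - y) (g y)
  rw [← biotSavartCLM_apply, ← biotSavartCLM_apply, ← biotSavartCLM_apply, map_add]

/-- The Newtonian potential of a density supported at distance `≥ d > 0` from `x` is bounded by
`(4πd)⁻¹ ∫‖g‖`. [folklore] -/
private theorem norm_integral_newtonKernel_smul_le_of_dist
    {g : (EuclideanSpace ℝ (Fin 3)) → (EuclideanSpace ℝ (Fin 3))} (hg : Continuous g)
    (hgc : HasCompactSupport g) {x : (EuclideanSpace ℝ (Fin 3))} {d : ℝ} (hd : 0 < d)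
    (hfar : ∀ y, g y ≠ 0 → d ≤ ‖x - y‖) :
    ‖∫ y, newtonKernel (x - y) • g y‖ ≤ (4 * π * d)⁻¹ * ∫ y, ‖g y‖ := by
  have hgi : Integrable g := hg.integrable_of_hasCompactSupport hgc
  have hpt : ∀ y, ‖newtonKernel (x - y) • g y‖ ≤ (4 * π * d)⁻¹ * ‖g y‖ := by
    intro y
    by_cases hy : g y = 0
    · rw [hy, smul_zero, norm_zero, mul_zero]
    · have hdy := hfar y hy
      have hxy : 0 < ‖x - y‖ := hd.trans_le hdy
      rw [norm_smul, Real.norm_eq_abs, abs_newtonKernel]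
      refine mul_le_mul_of_nonneg_right ?_ (norm_nonneg _)
      rw [inv_le_inv₀ (by positivity) (by positivity)]
      gcongr
  calc ‖∫ y, newtonKernel (x - y) • g y‖ ≤ ∫ y, ‖newtonKernel (x - y) • g y‖ :=
        norm_integral_le_integral_norm _
    _ ≤ ∫ y, (4 * π * d)⁻¹ * ‖g y‖ :=
        integral_mono_of_nonneg (Eventually.of_forall fun y => norm_nonneg _)
          (hgi.norm.const_mul _) (Eventually.of_forall hpt)
    _ = (4 * π * d)⁻¹ * ∫ y, ‖g y‖ := integral_const_mul _ _

set_option maxHeartbeats 800000 in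
/-- **Sup bound for the velocity generated by the low vorticity, local form** (the local substitute
for `exists_norm_sub_biotSavart_le`; Grujić 2009 §3–§4: the lower-order terms of the localization
formula are controlled by Leray-class quantities on the larger cylinder). Fix a centre `c` and a
radius `s > 0`, and let `χ = ballCutoff c (2s)` (`= 1` on `B̄(c,4s)`, `= 0` off `B(c,6s)`). There is
`C ≥ 0` (depending on `c, s`) such that: for every `V ∈ C²(ℝ³;ℝ³)` divergence free on `B(c, 6s)`,
every continuous `b` with `‖curl V(y) − b(y)‖ ≤ Λ` on `B(c, 6s)`, and every `x ∈ B(c, 3s)`,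
`‖V(x) − (K ∗ (χ b))(x)‖ ≤ 30 Λ s + C ∫_{B̄(c,6s)} (‖curl V‖ + ‖DV‖ + ‖V‖)`.
Proof: `V(x) = χ(x)V(x) = K∗(χ curl V)(x) + ∫Γ(x−y)G(y)dy` (`smul_eq_biotSavart_add_integral_newtonKernel`),
`K∗(χ curl V) − K∗(χb) = K∗(χ(curl V − b))` is bounded by `5Λ·6s` (Majda–Bertozzi Lemma 4.5,
`norm_biotSavart_le_of_support_subset`), and `G` lives on the shell `4s ≤ |y−c| ≤ 6s`, at distance
`≥ s` from `x`, where `|Γ(x−y)| ≤ (4πs)⁻¹` and `‖G‖ ≤ C'(‖curl V‖ + ‖DV‖ + ‖V‖)`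
(`norm_laplacian_smul_add_curl_smul_curl_le`). [cite: Grujic2009, §3 (3)–(4) and §4 (7) (pp. 864–866); MajdaBertozziCUP2002, §4.1.3 Lemma 4.5] -/
theorem exists_norm_sub_biotSavart_ballCutoff_le (c : (EuclideanSpace ℝ (Fin 3))) {s : ℝ} (hs : 0 < s) :
    ∃ C : ℝ, 0 ≤ C ∧
      ∀ ⦃V : (EuclideanSpace ℝ (Fin 3)) → (EuclideanSpace ℝ (Fin 3))⦄ (_ : ContDiff ℝ 2 V)
        (_ : ∀ y ∈ ball c (6 * s), VectorCalculus.divergence V y = 0)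
        ⦃b : (EuclideanSpace ℝ (Fin 3)) → (EuclideanSpace ℝ (Fin 3))⦄ (_ : Continuous b) ⦃Λ : ℝ⦄
        (_ : ∀ y ∈ ball c (6 * s), ‖curl V y - b y‖ ≤ Λ)
        ⦃x : (EuclideanSpace ℝ (Fin 3))⦄ (_ : x ∈ ball c (3 * s)),
        ‖V x - biotSavart (fun y => ballCutoff c (2 * s) y • b y) x‖ ≤
          30 * Λ * s + C * ∫ y in closedBall c (6 * s), (‖curl V y‖ + ‖fderiv ℝ V y‖ + ‖V y‖) := by
  -- the cutoff and its derivative bounds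
  have h2s : 0 < 2 * s := by positivity
  set χ : (EuclideanSpace ℝ (Fin 3)) → ℝ := ballCutoff c (2 * s) with hχdef
  have hχ : ContDiff ℝ 2 χ := contDiff_ballCutoff c (2 * s)
  have hχ1 : ContDiff ℝ 1 χ := contDiff_ballCutoff c (2 * s)
  have hχc : HasCompactSupport χ := hasCompactSupport_ballCutoff h2s
  obtain ⟨B₁, hB₁⟩ := (hχ1.continuous_fderiv one_ne_zero).bounded_above_of_compact_support
    (hχc.fderiv (𝕜 := ℝ))
  have hΔχc : Continuous (Δ χ) := (contDiff_laplacian (n := 0) (by exact hχ)).continuous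
  have hΔχs : HasCompactSupport (Δ χ) :=
    HasCompactSupport.of_support_subset_isCompact hχc.isCompact fun y hy => by
      by_contra h
      exact hy (laplacian_eq_zero_of_notMem_tsupport h)
  obtain ⟨B₂, hB₂⟩ := hΔχc.bounded_above_of_compact_support hΔχs
  have hB₁0 : 0 ≤ B₁ := (norm_nonneg _).trans (hB₁ c)
  have hB₂0 : 0 ≤ B₂ := (norm_nonneg _).trans (hB₂ c)
  set C' : ℝ := max (‖curlCLM‖ * B₁) (max (6 * B₁) B₂) with hC'
  have hC'0 : 0 ≤ C' := le_max_of_le_right (le_max_of_le_right hB₂0)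
  have hC'1 : ‖curlCLM‖ * B₁ ≤ C' := le_max_left _ _
  have hC'2 : 6 * B₁ ≤ C' := le_max_of_le_right (le_max_left _ _)
  have hC'3 : B₂ ≤ C' := le_max_of_le_right (le_max_right _ _)
  refine ⟨(4 * π * s)⁻¹ * C', by positivity, ?_⟩
  intro V hV hdiv b hb Λ hΛ x hx
  have hΛ0 : 0 ≤ Λ := (norm_nonneg _).trans (hΛ c (mem_ball_self (by positivity)))
  -- basic objects
  have hV1 : ContDiff ℝ 1 V := hV.of_le (by norm_num)
  have hVc : Continuous V := hV.continuous
  have hDVc : Continuous (fderiv ℝ V) := hV.continuous_fderiv (by norm_num)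
  have hω1 : ContDiff ℝ 1 (curl V) := contDiff_curl (n := 1) (by exact hV)
  have hωc : Continuous (curl V) := hω1.continuous
  have hχcont : Continuous χ := hχ.continuous
  have hχ01 : ∀ y, 0 ≤ χ y ∧ χ y ≤ 1 := fun y => ⟨ballCutoff_nonneg _ _ _, ballCutoff_le_one _ _ _⟩
  -- `χ = 1` near `x`, `χ = 0` off `B(c, 6s)`
  have hxc : ‖x - c‖ < 3 * s := by rwa [mem_ball, dist_eq_norm] at hx
  have hχx : χ x = 1 := ballCutoff_eq_one h2s (by linarith)
  have hχ0 : ∀ y, y ∉ ball c (6 * s) → χ y = 0 := fun y hy => by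
    rw [mem_ball, dist_eq_norm, not_lt] at hy
    exact ballCutoff_eq_zero h2s (by linarith)
  -- the densities `χ(ω - b)` and `χ b`
  set fa : (EuclideanSpace ℝ (Fin 3)) → (EuclideanSpace ℝ (Fin 3)) := fun y => χ y • (curl V y - b y) with hfa
  set fb : (EuclideanSpace ℝ (Fin 3)) → (EuclideanSpace ℝ (Fin 3)) := fun y => χ y • b y with hfb
  have hfac : Continuous fa := hχcont.smul (hωc.sub hb)
  have hfbc : Continuous fb := hχcont.smul hb
  have hfas : HasCompactSupport fa := hχc.smul_right
  have hfbs : HasCompactSupport fb := hχc.smul_right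
  have hfa_le : ∀ y, ‖fa y‖ ≤ Λ := by
    intro y
    by_cases hy : y ∈ ball c (6 * s)
    · rw [hfa]
      simp only
      rw [norm_smul, Real.norm_eq_abs, abs_of_nonneg (hχ01 y).1]
      calc χ y * ‖curl V y - b y‖ ≤ 1 * Λ :=
            mul_le_mul (hχ01 y).2 (hΛ y hy) (norm_nonneg _) zero_le_one
        _ = Λ := one_mul _
    · rw [hfa]
      simp only
      rw [hχ0 y hy, zero_smul, norm_zero]
      exact hΛ0
  obtain ⟨Mb, hMb⟩ := hfbc.bounded_above_of_compact_support hfbs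
  have hfa_supp : support fa ⊆ closedBall c (6 * s) := by
    intro y hy
    by_contra h
    have h' : y ∉ ball c (6 * s) := fun h'' => h (ball_subset_closedBall h'')
    exact hy (by rw [hfa]; simp only; rw [hχ0 y h', zero_smul])
  -- (1) the Biot–Savart bound for the low part
  have hKa : ‖biotSavart fa x‖ ≤ 30 * Λ * s := by
    have h := norm_biotSavart_le_of_support_subset (by positivity : 0 < 6 * s) hfa_le hfa_supp x
    calc ‖biotSavart fa x‖ ≤ 5 * Λ * (6 * s) := h
      _ = 30 * Λ * s := by ring
  -- (2) splitting `K ∗ (χω) = K ∗ fa + K ∗ fb`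
  have hsplit : biotSavart (fun y => χ y • curl V y) x = biotSavart fa x + biotSavart fb x := by
    have heq : (fun y => χ y • curl V y) = fun y => fa y + fb y := by
      funext y
      simp only [hfa, hfb, smul_sub, sub_add_cancel]
    rw [heq]
    exact biotSavart_add_of_bounded hfac.measurable (hfac.integrable_of_hasCompactSupport hfas) hfa_le
      hfbc.measurable (hfbc.integrable_of_hasCompactSupport hfbs) hMb x
  -- (3) the lower-order density `G` and its support
  set G : (EuclideanSpace ℝ (Fin 3)) → (EuclideanSpace ℝ (Fin 3)) := fun y =>
    (Δ (fun z => χ z • V z)) y + curl (fun z => χ z • curl V z) y with hGdef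
  have hU2 : ContDiff ℝ 2 (fun z => χ z • V z) := hχ.smul hV
  have hUc : HasCompactSupport (fun z => χ z • V z) := hχc.smul_right
  have hΦ1 : ContDiff ℝ 1 (fun z => χ z • curl V z) := hχ1.smul hω1
  have hΦc : HasCompactSupport (fun z => χ z • curl V z) := hχc.smul_right
  have hGc : Continuous G :=
    (contDiff_laplacian (n := 0) (by exact hU2)).continuous.add (continuous_curl hΦ1)
  have hGs : HasCompactSupport G := by
    refine HasCompactSupport.add ?_ (hasCompactSupport_curl hΦc)
    exact HasCompactSupport.of_support_subset_isCompact hUc.isCompact fun y hy => by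
      by_contra h
      exact hy (laplacian_eq_zero_of_notMem_tsupport h)
  -- the divergence hypothesis in the pointwise form
  have hdivpt : ∀ y, χ y = 0 ∨ ∀ᶠ z in 𝓝 y, VectorCalculus.divergence V z = 0 := by
    intro y
    by_cases hy : y ∈ ball c (6 * s)
    · exact Or.inr (eventually_of_mem (isOpen_ball.mem_nhds hy) fun z hz => hdiv z hz)
    · exact Or.inl (hχ0 y hy)
  -- `G = 0` on the plateau `B(c, 4s)` and off `B̄(c, 6s)`
  have hG0_in : ∀ y, ‖y - c‖ < 4 * s → G y = 0 := by
    intro y hy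
    have hy' : y ∈ ball c (2 * (2 * s)) := by
      rw [mem_ball, dist_eq_norm]; linarith
    exact laplacian_smul_add_curl_smul_curl_eq_zero_of_eventuallyEq_const hV hχ
      (ballCutoff_eventuallyEq_one h2s hy') (hdivpt y)
  have hG0_out : ∀ y, 6 * s < ‖y - c‖ → G y = 0 := by
    intro y hy
    have hy' : y ∉ closedBall c (3 * (2 * s)) := by
      rw [mem_closedBall, dist_eq_norm, not_le]; linarith
    exact laplacian_smul_add_curl_smul_curl_eq_zero_of_eventuallyEq_const hV hχ
      (ballCutoff_eventuallyEq_zero h2s hy') (hdivpt y)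
  -- distance from `x` to the support of `G`
  have hfar : ∀ y, G y ≠ 0 → s ≤ ‖x - y‖ := by
    intro y hy
    have h4 : 4 * s ≤ ‖y - c‖ := by
      by_contra h
      exact hy (hG0_in y (not_le.1 h))
    have htri : ‖y - c‖ ≤ ‖x - y‖ + ‖x - c‖ := by
      calc ‖y - c‖ = ‖(x - c) - (x - y)‖ := by congr 1; abel
        _ ≤ ‖x - c‖ + ‖x - y‖ := norm_sub_le _ _
        _ = ‖x - y‖ + ‖x - c‖ := add_comm _ _
    linarith
  -- (4) the Newtonian term
  have hN : ‖∫ y, newtonKernel (x - y) • G y‖ ≤ (4 * π * s)⁻¹ * ∫ y, ‖G y‖ :=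
    norm_integral_newtonKernel_smul_le_of_dist hGc hGs hs hfar
  -- pointwise bound for `‖G‖` by the local densities
  set h : (EuclideanSpace ℝ (Fin 3)) → ℝ := fun y => ‖curl V y‖ + ‖fderiv ℝ V y‖ + ‖V y‖ with hhdef
  have hhc : Continuous h := (hωc.norm.add hDVc.norm).add hVc.norm
  have hh0 : ∀ y, 0 ≤ h y := fun y => by positivity
  have hGpt : ∀ y, ‖G y‖ ≤ C' * (closedBall c (6 * s)).indicator h y := by
    intro y
    by_cases hy : y ∈ closedBall c (6 * s)
    · rw [indicator_of_mem hy]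
      have hb1 : ‖fderiv ℝ χ y‖ ≤ B₁ := hB₁ y
      have hb2 : |(Δ χ) y| ≤ B₂ := by
        have := hB₂ y; rwa [Real.norm_eq_abs] at this
      calc ‖G y‖ ≤ ‖curlCLM‖ * ‖fderiv ℝ χ y‖ * ‖curl V y‖ + 6 * ‖fderiv ℝ χ y‖ * ‖fderiv ℝ V y‖ +
            |(Δ χ) y| * ‖V y‖ := norm_laplacian_smul_add_curl_smul_curl_le hV hχ (hdivpt y)
        _ ≤ C' * ‖curl V y‖ + C' * ‖fderiv ℝ V y‖ + C' * ‖V y‖ := by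
            have e1 : ‖curlCLM‖ * ‖fderiv ℝ χ y‖ ≤ C' :=
              (mul_le_mul_of_nonneg_left hb1 (norm_nonneg _)).trans hC'1
            have e2 : 6 * ‖fderiv ℝ χ y‖ ≤ C' :=
              (mul_le_mul_of_nonneg_left hb1 (by norm_num)).trans hC'2
            have e3 : |(Δ χ) y| ≤ C' := hb2.trans hC'3
            gcongr
        _ = C' * h y := by rw [hhdef]; ring
    · rw [indicator_of_notMem hy, mul_zero]
      rw [mem_closedBall, dist_eq_norm, not_le] at hy
      rw [hG0_out y hy, norm_zero]
  have hhi : IntegrableOn h (closedBall c (6 * s)) :=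
    hhc.continuousOn.integrableOn_compact (isCompact_closedBall c (6 * s))
  have hind : Integrable fun y => C' * (closedBall c (6 * s)).indicator h y :=
    ((integrable_indicator_iff measurableSet_closedBall).2 hhi).const_mul C'
  have hGint : ∫ y, ‖G y‖ ≤ C' * ∫ y in closedBall c (6 * s), h y := by
    calc ∫ y, ‖G y‖ ≤ ∫ y, C' * (closedBall c (6 * s)).indicator h y :=
          integral_mono_of_nonneg (Eventually.of_forall fun y => norm_nonneg _) hind
            (Eventually.of_forall hGpt)
      _ = C' * ∫ y in closedBall c (6 * s), h y := by
          rw [integral_const_mul, integral_indicator measurableSet_closedBall]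
  -- (5) assemble
  have hrep := smul_eq_biotSavart_add_integral_newtonKernel hV hχ hχc x
  rw [hχx, one_smul, hsplit] at hrep
  have hdiff : V x - biotSavart fb x = biotSavart fa x + ∫ y, newtonKernel (x - y) • G y := by
    rw [hrep]; abel
  have hint0 : 0 ≤ ∫ y in closedBall c (6 * s), h y := setIntegral_nonneg measurableSet_closedBall fun y _ => hh0 y
  calc ‖V x - biotSavart fb x‖ = ‖biotSavart fa x + ∫ y, newtonKernel (x - y) • G y‖ := by rw [hdiff]
    _ ≤ ‖biotSavart fa x‖ + ‖∫ y, newtonKernel (x - y) • G y‖ := norm_add_le _ _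
    _ ≤ 30 * Λ * s + (4 * π * s)⁻¹ * ∫ y, ‖G y‖ := add_le_add hKa hN
    _ ≤ 30 * Λ * s + (4 * π * s)⁻¹ * (C' * ∫ y in closedBall c (6 * s), h y) := by
        gcongr
    _ = 30 * Λ * s + (4 * π * s)⁻¹ * C' * ∫ y in closedBall c (6 * s), h y := by ring

end Literature.Analysis.FluidPDE

end
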